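import Summits.QuantumFields.BalabanUV.Beta.D1BFx.KCombineCovStripped
import Summits.QuantumFields.BalabanUV.Beta.D1BFx.MovingTableSockets

/-!
# `BalabanUV.Beta.D1BFx.KCombineCovStrippedUniform` — road «BF-x» for binder row D1, slot (K), chain step (I) «(A1)-PACKED», brick **(B6) «A1-PACKED»
# (generic form)**: `KCombineCovStripped.hessKer_transfer_road_cov_stripped` — the `ℤ⁴` identity of the COVARIANT organisation from parity-typed
# per-torus letters — RE-RUN WITH k-INDEXED M- AND N-SIDE TABLE FAMILIES (FINDING F-g16-1 «WRAP»: at second order the per-torus dictionary is exact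
# only with p-DEPENDENT `ℤ⁴` tables), the `ℤ⁴` identity holding AT THE LIMIT FAMILIES

HONEST FRAMING (cell contract, verbatim): «discharging `BetaPertH` makes Bałaban's UV stability UNCONDITIONAL — a real constructive-QFT
result; it is NOT the continuum limit and NOT the Clay problem.»  HONEST DEPENDENCY (verbatim): «continuum YM on T⁴ ⇐ BetaPertH ∧ nine
spine estimates (0/9 proved); BetaPertH ⇐ (D1) ∧ (D4) ∧ CAP+tail; G-an2-4 gates asym, D1 and NE2/3/4.»  THIS MODULE DISCHARGES NOTHING of
D1 ∕ BetaPertH: [folklore] a composition BY NAME — the per-torus body of `KCombineCovStripped.hessKer_transfer_road_cov_stripped` VERBATIM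
(`KCombineCovColourTorus.identity_array_currency_cov_What0_stripped` fed with the literal's parity-typed jets, the WARD-L ∕ kinematic letters, the
(A2-M∕N) dictionary letters at the k-TH tables, TB4-W's pinned co-frame data, THE CONVENTION's gauge jets, the five determinants and both tower slots BY
NAME) and, for the `ℤ⁴` passage, `MovingTableSockets.hessKer_transfer_road_cov_limits_of_uniform` (M side) ∕ `tendsto_hessT_NlegRoad_of_uniform` (N side)
over this lineage's g9 uniform sockets (`TorusArrayLimitUniform` ∕ `SortedArrayLimitUniform`, ruling ρ-g7-8) in place of the fixed-family TB5-2a∕2b.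
No `def`, no `def … : Prop`, nothing cited, 0 sorry.  NOT summit progress; NOT BetaPertH, NOT continuum, NOT Clay.
STILL DISPLAYED (what (B3) ∕ «WRAP-LIMIT» ∕ «WRAP-UNIFORM» supply for the PACKED data, and what stays the literal's): the per-torus WARD-L letters `a•`,
the kinematic letters `b•`, the (A2-M∕N) dictionary `hJM• k`∕`hJN• k` AT THE k-TH TABLES ((B3); first order with the constant families — exact, (B4)),
the uniform `BiLoc` letters of the four families (gan24-leaf-05's «WRAP-UNIFORM», re-centred to TA3b's tied points) and their entrywise limits
(«WRAP-LIMIT» composed with `s k := (m+1)·p k`); `Spr (Ga (m+1) a)`, `0 < a`, `r ∈ box 4 (m+1)`.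

ABSOLUTE RULE (cell, verbatim): «No internally-minted statement may enter as a cited fact. Every hypothesis is either kernel-proved in this
package or a verbatim quotation of a PUBLISHED theorem with page reference. The manuscript(s) under audit are NOT citable for their own
disputed steps — they are the thing under adjudication; programme-internal (2001/route/tribunal) claims are never citable.»

CONTENT (all [folklore]): **`hessKer_transfer_road_cov_stripped_of_uniform`**:
`hessKer G_M 𝒱M∞ 𝒲M∞ μ ν z + hessKer (Cgh (m+1) a) Lgh Lgh₂ μ ν z = hessKer (NlegRoad m a) 𝒱N∞ 𝒲N∞ μ ν z + 2·hessKer idK1 nFcol nFcolMix μ ν z`,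
`G_M = coDressKBmAt (toSite r) (m+1) (KInvStep (m+1) 0)`, for k-indexed families `𝒱M k`, `𝒲M k`, `𝒱N k`, `𝒲N k` under (u1) uniform `BiLoc` + (u2) entrywise
limits, the per-torus letters holding at the k-th members.  At constant families this is `KCombineCovStripped.hessKer_transfer_road_cov_stripped`.
Unit `b2b-balaban-beta-d1-formalise-leaf-03` (gen 21); road owner `b2b-balaban-beta-d1-p2` (F-g16-1, `A1-PACKED-SPEC.md` v0.3.1 §8 bricks (B5′)∕(B6)).
-/

noncomputable section

namespace Summit.QuantumFields.BalabanUV.Beta.D1BFx.KCombineCovStrippedUniform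

open Matrix Filter Topology
open scoped BigOperators
open Literature.MathematicalPhysics.QuantumFieldTheory.Balaban1983to89
open Literature.MathematicalPhysics.QuantumFieldTheory.Balaban1983to89.Beta
open Literature.MathematicalPhysics.QuantumFieldTheory.Balaban1983to89.Beta.Composition (kkt)
open B12Sec2to5 (l1 l1_nonneg)
open ExpKernelCalculus (MKer Decays BiLoc hessKer)
open AffineAveraging (box toSite unitVec)
open OneStepResolventKernel (Fib)
open OneStepKernelFamily (KInvStep)
open Summit.QuantumFields.BalabanUV.Beta.TameKernelCalculus (Spr)
open Summit.QuantumFields.BalabanUV.Beta.AxialDressingRooted (coDressKBmAt)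
open Summit.QuantumFields.BalabanUV.Beta.D1BFx.FibredPeriodisation (periodiseF)
open Summit.QuantumFields.BalabanUV.Beta.D1BFx.SortedKernels (blocksHat)
open Summit.QuantumFields.BalabanUV.Beta.D1BFx.SortedPack (sortK)
open Summit.QuantumFields.BalabanUV.Beta.D1BFx.SortedEmbedding (e₁)
open Summit.QuantumFields.BalabanUV.Beta.D1BFx.PeriodicArrays (arr toF)
open Summit.QuantumFields.BalabanUV.Beta.D1BFx.MixedVarPackedHess (hessT)
open Summit.QuantumFields.BalabanUV.Beta.D1BFx.GramWeightJets (gram₀)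
open Summit.QuantumFields.BalabanUV.Beta.D1BFx.GramWeightColourLift (tj₂ tgram₁ tgramMix)
open Summit.QuantumFields.BalabanUV.Beta.D1BFx.TorusCombKKT (I J CombRows tauT Khat Qhat)
open Summit.QuantumFields.BalabanUV.Beta.D1BFx.TorusGaugeBasis (What0)
open Summit.QuantumFields.BalabanUV.Beta.D1BFx.TorusGaugeBasisMatrix (Nhat)
open Summit.QuantumFields.BalabanUV.Beta.D1BFx.TorusCoframeJets (Djet Tjet₀ Tjet₁ Tjet₁₁ Ajet₀ Ajet₁ Ajet₁₁)
open Summit.QuantumFields.BalabanUV.Beta.D1BFx.RWeightedLegPack (NlegRoad)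
open Summit.QuantumFields.BalabanUV.Beta.D1BFx.GaugeJetLocal (idK1)
open Summit.QuantumFields.BalabanUV.Beta.D1BFx.KGhostLeg (Cgh)
open Summit.QuantumFields.BalabanUV.Beta.D1BFx.TorusGhostWordArrays (Lgh)
open Summit.QuantumFields.BalabanUV.Beta.D1BFx.TorusGhostPairStencils (Lgh₂)
open Summit.QuantumFields.BalabanUV.Beta.D1BFx.CombFPWordArrays (nFcol hessT_combFP_What0_eq_arr)
open Summit.QuantumFields.BalabanUV.Beta.D1BFx.KCombineCovLegs (det_Tjet₀_mul_What0_ne_zero det_Ajet₀_Nhat_ne_zero det_gram₀_What0_road_ne_zero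
  inv_kkt_gram₀_Tjet_Nhat_eq_blocksHat)
open Summit.QuantumFields.BalabanUV.Beta.D1BFx.KCombineCovTowers (combFPMix_eq_of_lt tendsto_gramCov_tower tendsto_combFP_tower)
open Summit.QuantumFields.BalabanUV.Beta.D1BFx.KCombineCovColourTorus (identity_array_currency_cov_What0_stripped hessT_tgramCov_What0_eq_arr
  transpose_Ajet₀ transpose_Ajet₁ transpose_Ajet₁₁)
open Summit.QuantumFields.BalabanUV.Beta.D1BFx.KCombineCovStripped (eventually_l1_add_three_le)
open Summit.QuantumFields.BalabanUV.Beta.D1BFx.MovingTableSockets (hessKer_transfer_road_cov_limits_of_uniform tendsto_hessT_NlegRoad_of_uniform)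

/-! ## The `ℤ⁴` identity from parity-typed per-torus letters, k-indexed table families -/

section Combine

variable (m : ℕ) {a : ℝ} {r : Fin 4 → ℕ}

/-- [folklore] **«A1-PACKED» (generic) — «K-COV-C» PART 3 WITH k-INDEXED M- AND N-SIDE TABLE FAMILIES.**  For `0 < a`, `Spr (Ga (m+1) a)`, `r ∈ box 4 (m+1)`,
k-indexed M∕N table families `𝒱M k`, `𝒲M k`, `𝒱N k`, `𝒲N k` whose base-point jets are bi-localised UNIFORMLY in `k` ((u1), at TA3b's tied points) and converge
ENTRYWISE to `𝒱M∞`, `𝒲M∞`, `𝒱N∞`, `𝒲N∞` ((u2)), coarse periods `p k → ∞`, and ON EVERY TORUS `p k` the data of `KCombineCovStripped.hessKer_transfer_road_cov_stripped`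
(co-frame data pinned to TB4-W's jets, gauge jets pinned to THE CONVENTION, the literal's parity-typed form ∕ constraint jets with their one-sided WARD-L and
kinematic letters) with the (A2-M∕N) DICTIONARY letters AT THE k-TH TABLES — `kkt (kₛ k) (qₛ k) = (arr (𝒱M k μ 0))ˆ`, `kkt (kₜ k) (qₜ k) = (arr (𝒱M k ν z))ˆ`,
`kkt (kₛₜ k) (qₛₜ k) · D = (arr (𝒲M k μ 0 ν z))ˆ`, and the N-side twins with TB4-W's twisted weight jets:
`hessKer G_M 𝒱M∞ 𝒲M∞ μ ν z + hessKer (Cgh (m+1) a) Lgh Lgh₂ μ ν z = hessKer (NlegRoad m a) 𝒱N∞ 𝒲N∞ μ ν z + 2·hessKer idK1 nFcol nFcolMix μ ν z`. -/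
theorem hessKer_transfer_road_cov_stripped_of_uniform (ha : 0 < a) (hGa : Spr (GluonLeg.Ga (m + 1) a)) (hr : r ∈ box (3 + 1) (m + 1))
    (𝒱M : ℕ → Fin 4 → (Fin 4 → ℤ) → MKer 4 (Fib 3)) (𝒲M : ℕ → Fin 4 → (Fin 4 → ℤ) → Fin 4 → (Fin 4 → ℤ) → MKer 4 (Fib 3))
    (𝒱Minf : Fin 4 → (Fin 4 → ℤ) → MKer 4 (Fib 3)) (𝒲Minf : Fin 4 → (Fin 4 → ℤ) → Fin 4 → (Fin 4 → ℤ) → MKer 4 (Fib 3))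
    (𝒱N : ℕ → Fin 4 → (Fin 4 → ℤ) → MKer 4 (Fib 3)) (𝒲N : ℕ → Fin 4 → (Fin 4 → ℤ) → Fin 4 → (Fin 4 → ℤ) → MKer 4 (Fib 3))
    (𝒱Ninf : Fin 4 → (Fin 4 → ℤ) → MKer 4 (Fib 3)) (𝒲Ninf : Fin 4 → (Fin 4 → ℤ) → Fin 4 → (Fin 4 → ℤ) → MKer 4 (Fib 3))
    (μ ν : Fin 4) (z : Fin 4 → ℤ)
    {PM PM' QM QM' PN PN' QN QN' : Fin 4 → ℤ} {CvM CvM' CM δM CvN CvN' CN δN : ℝ}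
    (hVM : ∀ k, BiLoc (𝒱M k μ 0) PM PM' CvM δM) (hVM' : ∀ k, BiLoc (𝒱M k ν z) QM' QM CvM' δM)
    (hWM : ∀ k, BiLoc (𝒲M k μ 0 ν z) PM QM CM δM) (hδM : 0 < δM)
    (hlimVM : ∀ x y c b, Tendsto (fun k => 𝒱M k μ 0 x y c b) atTop (𝓝 (𝒱Minf μ 0 x y c b)))
    (hlimVM' : ∀ x y c b, Tendsto (fun k => 𝒱M k ν z x y c b) atTop (𝓝 (𝒱Minf ν z x y c b)))
    (hlimWM : ∀ x y c b, Tendsto (fun k => 𝒲M k μ 0 ν z x y c b) atTop (𝓝 (𝒲Minf μ 0 ν z x y c b)))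
    (hVN : ∀ k, BiLoc (𝒱N k μ 0) PN PN' CvN δN) (hVN' : ∀ k, BiLoc (𝒱N k ν z) QN' QN CvN' δN)
    (hWN : ∀ k, BiLoc (𝒲N k μ 0 ν z) PN QN CN δN) (hδN : 0 < δN)
    (hlimVN : ∀ x y c b, Tendsto (fun k => 𝒱N k μ 0 x y c b) atTop (𝓝 (𝒱Ninf μ 0 x y c b)))
    (hlimVN' : ∀ x y c b, Tendsto (fun k => 𝒱N k ν z x y c b) atTop (𝓝 (𝒱Ninf ν z x y c b)))
    (hlimWN : ∀ x y c b, Tendsto (fun k => 𝒲N k μ 0 ν z x y c b) atTop (𝓝 (𝒲Ninf μ 0 ν z x y c b)))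
    {p : ℕ → ℕ} [∀ k, NeZero (p k)] (hp : Tendsto p atTop atTop)
    -- co-frame data pinned to TB4-W's jets
    (T₀ Tₛ Tₜ Tₛₜ : ∀ k, Matrix (CombRows (toSite r) (m + 1) (p k)) (I 3 (m + 1) (p k)) ℝ)
    (A₀ Aₛ Aₜ Aₛₜ : ∀ k, Matrix (CombRows (toSite r) (m + 1) (p k)) (CombRows (toSite r) (m + 1) (p k)) ℝ)
    (hT₀ : ∀ k, T₀ k = Tjet₀ ((m + 1) * p k) (Nhat r (m + 1) (p k)) (e₁ (m + 1) (p k)))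
    (hTₛ : ∀ k, Tₛ k = Tjet₁ ((m + 1) * p k) (siteOf 4 ((m + 1) * p k) 0, μ) (Nhat r (m + 1) (p k)) (e₁ (m + 1) (p k)))
    (hTₜ : ∀ k, Tₜ k = Tjet₁ ((m + 1) * p k) (siteOf 4 ((m + 1) * p k) z, ν) (Nhat r (m + 1) (p k)) (e₁ (m + 1) (p k)))
    (hTₛₜ : ∀ k, Tₛₜ k = Tjet₁₁ ((m + 1) * p k) (siteOf 4 ((m + 1) * p k) 0, μ) (siteOf 4 ((m + 1) * p k) z, ν)
      (Nhat r (m + 1) (p k)) (e₁ (m + 1) (p k)))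
    (hA₀ : ∀ k, A₀ k = Ajet₀ ((m + 1) * p k) (Nhat r (m + 1) (p k)))
    (hAₛ : ∀ k, Aₛ k = Ajet₁ ((m + 1) * p k) (siteOf 4 ((m + 1) * p k) 0, μ) (Nhat r (m + 1) (p k)))
    (hAₜ : ∀ k, Aₜ k = Ajet₁ ((m + 1) * p k) (siteOf 4 ((m + 1) * p k) z, ν) (Nhat r (m + 1) (p k)))
    (hAₛₜ : ∀ k, Aₛₜ k = Ajet₁₁ ((m + 1) * p k) (siteOf 4 ((m + 1) * p k) 0, μ) (siteOf 4 ((m + 1) * p k) z, ν) (Nhat r (m + 1) (p k)))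
    -- gauge jets pinned to THE CONVENTION
    (Wₛ Wₜ Wₛₜ : ∀ k, Matrix (I 3 (m + 1) (p k)) (CombRows (toSite r) (m + 1) (p k)) ℝ)
    (hWₛ : ∀ k, Wₛ k = (Djet ((m + 1) * p k) (siteOf 4 ((m + 1) * p k) 0, μ)).submatrix (e₁ (m + 1) (p k)) id * Nhat r (m + 1) (p k))
    (hWₜ : ∀ k, Wₜ k = (Djet ((m + 1) * p k) (siteOf 4 ((m + 1) * p k) z, ν)).submatrix (e₁ (m + 1) (p k)) id * Nhat r (m + 1) (p k))
    (hWₛₜ : ∀ k, Wₛₜ k = if (siteOf 4 ((m + 1) * p k) 0, μ) = (siteOf 4 ((m + 1) * p k) z, ν)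
      then (Djet ((m + 1) * p k) (siteOf 4 ((m + 1) * p k) 0, μ)).submatrix (e₁ (m + 1) (p k)) id * Nhat r (m + 1) (p k) else 0)
    -- the literal's parity-typed jets, WARD-L one-sided letters, kinematic letters
    (kₛ kₜ kₛₜ : ∀ k, Matrix (I 3 (m + 1) (p k)) (I 3 (m + 1) (p k)) ℝ) (qₛ qₜ qₛₜ : ∀ k, Matrix (J 3 (p k)) (I 3 (m + 1) (p k)) ℝ)
    (hkₛ : ∀ k, (kₛ k)ᵀ = -kₛ k) (hkₜ : ∀ k, (kₜ k)ᵀ = -kₜ k) (hkₛₜ : ∀ k, (kₛₜ k)ᵀ = kₛₜ k)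
    (aₛ : ∀ k, kₛ k * What0 r (m + 1) (p k) + Khat (d := 3) (m + 1) (p k) * Wₛ k = 0)
    (aₜ : ∀ k, kₜ k * What0 r (m + 1) (p k) + Khat (d := 3) (m + 1) (p k) * Wₜ k = 0)
    (aₛₜ : ∀ k, kₛₜ k * What0 r (m + 1) (p k) + kₛ k * Wₜ k + kₜ k * Wₛ k + Khat (d := 3) (m + 1) (p k) * Wₛₜ k = 0)
    (bₛ : ∀ k, qₛ k * What0 r (m + 1) (p k) + Qhat (d := 3) (m + 1) (p k) * Wₛ k = 0)
    (bₜ : ∀ k, qₜ k * What0 r (m + 1) (p k) + Qhat (d := 3) (m + 1) (p k) * Wₜ k = 0)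
    (bₛₜ : ∀ k, qₛₜ k * What0 r (m + 1) (p k) + qₛ k * Wₜ k + qₜ k * Wₛ k + Qhat (d := 3) (m + 1) (p k) * Wₛₜ k = 0)
    -- the (A2-M∕N) dictionary AT THE k-TH TABLES
    (hJM : ∀ k, kkt (kₛ k) (qₛ k) = blocksHat (p k) (sortK (m + 1) (arr ((m + 1) * p k) (𝒱M k μ 0))))
    (hJM' : ∀ k, kkt (kₜ k) (qₜ k) = blocksHat (p k) (sortK (m + 1) (arr ((m + 1) * p k) (𝒱M k ν z))))
    (hJM'' : ∀ k, kkt (kₛₜ k) (qₛₜ k) * Matrix.fromBlocks (1 : Matrix (I 3 (m + 1) (p k)) (I 3 (m + 1) (p k)) ℝ) 0 0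
        (-1 : Matrix (J 3 (p k)) (J 3 (p k)) ℝ) = blocksHat (p k) (sortK (m + 1) (arr ((m + 1) * p k) (𝒲M k μ 0 ν z))))
    (hJN : ∀ k, tj₂ (kₛ k + tgram₁ (T₀ k) (Tₛ k) (A₀ k) (Aₛ k)) (qₛ k) = blocksHat (p k) (sortK (m + 1) (arr ((m + 1) * p k) (𝒱N k μ 0))))
    (hJN' : ∀ k, tj₂ (kₜ k + tgram₁ (T₀ k) (Tₜ k) (A₀ k) (Aₜ k)) (qₜ k) = blocksHat (p k) (sortK (m + 1) (arr ((m + 1) * p k) (𝒱N k ν z))))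
    (hJN'' : ∀ k, kkt (kₛₜ k + tgramMix (T₀ k) (Tₛ k) (Tₜ k) (Tₛₜ k) (A₀ k) (Aₛ k) (Aₜ k) (Aₛₜ k)) (qₛₜ k)
        = blocksHat (p k) (sortK (m + 1) (arr ((m + 1) * p k) (𝒲N k μ 0 ν z)))) :
    hessKer (coDressKBmAt (toSite r) (m + 1) (KInvStep (d := 3) (m + 1) 0)) 𝒱Minf 𝒲Minf μ ν z
        + hessKer (Cgh (m + 1) a) (fun κ v => Lgh κ v) (fun κ v l v' => Lgh₂ κ v l v') μ ν z
      = hessKer (NlegRoad m a) 𝒱Ninf 𝒲Ninf μ ν z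
        + 2 * hessKer idK1 (fun κ v => nFcol r (m + 1) κ v) (fun κ v l v' => if v = v' ∧ κ = l then nFcol r (m + 1) κ v else 0) μ ν z := by
  refine hessKer_transfer_road_cov_limits_of_uniform (d := 3) hr 𝒱M 𝒲M 𝒱Minf 𝒲Minf μ ν z hVM hVM' hWM hδM hlimVM hlimVM' hlimWM hp
    (tendsto_gramCov_tower m ha μ ν z hp)
    (tendsto_hessT_NlegRoad_of_uniform m hGa 𝒱N 𝒲N 𝒱Ninf 𝒲Ninf μ ν z hVN hVN' hWN hδN hlimVN hlimVN' hlimWN hp)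
    (tendsto_combFP_tower m hr μ ν z hp) ?_
  filter_upwards [eventually_l1_add_three_le m z hp] with k hk
  have hlt : l1 (0 - z) < (((m + 1) * p k : ℕ) : ℝ) := by linarith
  -- the TB4-W data letters on this torus, by name after un-pinning
  have hA₀s : (A₀ k)ᵀ = A₀ k := by rw [hA₀ k]; exact transpose_Ajet₀ _ _
  have hAₛa : (Aₛ k)ᵀ = -Aₛ k := by rw [hAₛ k]; exact transpose_Ajet₁ _ _ _
  have hAₜa : (Aₜ k)ᵀ = -Aₜ k := by rw [hAₜ k]; exact transpose_Ajet₁ _ _ _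
  have hAₛₜs : (Aₛₜ k)ᵀ = Aₛₜ k := by rw [hAₛₜ k]; exact transpose_Ajet₁₁ _ _ _ _
  have hTW : (T₀ k * What0 r (m + 1) (p k)).det ≠ 0 := by rw [hT₀ k]; exact det_Tjet₀_mul_What0_ne_zero m (p k) ha hr
  have hA : (A₀ k).det ≠ 0 := by rw [hA₀ k]; exact det_Ajet₀_Nhat_ne_zero m (p k) ha hr
  have hΦ : (gram₀ (What0 r (m + 1) (p k)) (Khat (d := 3) (m + 1) (p k) + gram₀ (T₀ k) (A₀ k))).det ≠ 0 := by
    rw [hT₀ k, hA₀ k]; exact det_gram₀_What0_road_ne_zero m (p k) ha hr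
  have hLN : (kkt (Khat (d := 3) (m + 1) (p k) + gram₀ (T₀ k) (A₀ k)) (Qhat (d := 3) (m + 1) (p k)))⁻¹
      = blocksHat (p k) (sortK (m + 1) (NlegRoad m a)) := by
    rw [hT₀ k, hA₀ k]; exact inv_kkt_gram₀_Tjet_Nhat_eq_blocksHat m (p k) ha hGa hr
  -- the two tower slots on this torus
  have hbΦ := hessT_tgramCov_What0_eq_arr m (p k) ha hr μ ν 0 z hk (kₛ k) (kₜ k) (kₛₜ k) (hWₛ k) (hWₜ k) (hWₛₜ k) (aₛ k) (aₜ k) (aₛₜ k)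
    (B₀ := gram₀ (T₀ k) (A₀ k)) (Bₛ := tgram₁ (T₀ k) (Tₛ k) (A₀ k) (Aₛ k)) (Bₜ := tgram₁ (T₀ k) (Tₜ k) (A₀ k) (Aₜ k))
    (Bₛₜ := tgramMix (T₀ k) (Tₛ k) (Tₜ k) (Tₛₜ k) (A₀ k) (Aₛ k) (Aₜ k) (Aₛₜ k))
    (by rw [hT₀ k, hA₀ k]) (by rw [hT₀ k, hTₛ k, hA₀ k, hAₛ k]) (by rw [hT₀ k, hTₜ k, hA₀ k, hAₜ k])
    (by rw [hT₀ k, hTₛ k, hTₜ k, hTₛₜ k, hA₀ k, hAₛ k, hAₜ k, hAₛₜ k])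
  have heτ := hessT_combFP_What0_eq_arr (m := m) (p := p k) hr μ ν 0 z (hWₛ k) (hWₜ k) (hWₛₜ k)
  rw [combFPMix_eq_of_lt m ((m + 1) * p k) μ ν 0 z hlt] at heτ
  exact identity_array_currency_cov_What0_stripped (d := 3) (p k) hr (kₛ k) (kₜ k) (kₛₜ k) (T₀ k) (Tₛ k) (Tₜ k) (Tₛₜ k)
    (A₀ k) (Aₛ k) (Aₜ k) (Aₛₜ k) (Wₛ k) (Wₜ k) (Wₛₜ k) (qₛ k) (qₜ k) (qₛₜ k) (hkₛ k) (hkₜ k) (hkₛₜ k) hA₀s hAₛa hAₜa hAₛₜs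
    (aₛ k) (aₜ k) (aₛₜ k) (bₛ k) (bₜ k) (bₛₜ k) hTW hA hΦ _ _ _ _ _ _ _ _ (hJM k) (hJM' k) (hJM'' k) hLN (hJN k) (hJN' k) (hJN'' k) hbΦ heτ

end Combine

end Summit.QuantumFields.BalabanUV.Beta.D1BFx.KCombineCovStrippedUniform

end
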